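import Summits.AtomisticToContinuum.HydrodynamicLimit.Theorems.JParityClosureParityBandClosureStressIsotropyOfWindowCovarianceC
import Literature.Analysis.FluidPDE.EmpiricalCollisionMeasure
import Literature.Analysis.FluidPDE.HardSphereRegularGeometry
import HarnessLib

/-!
# Window-to-cone step of `ParityBandClosure` — helper D: the speed-jump functional, its windows and the
# quartic collision statistic of `CollisionTightness`

Support file for the stub `stub_stressIsotropyOfWindowCovariance` of the line `transfer-weighted-parity-chain`
(skeleton v4) of the crux `JParityClosure.ParityBandClosure` (stmt-AtomisticToContinuum-17608).

WHAT.  Bookkeeping of the windowed normal-speed-jump functional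
`𝒮(a,b] = Σ_{t_c ∈ (a,b]} Σ_{(i,j) colliding} ‖vᵢ⁺ − vᵢ⁻‖` (`collisionalTransferFunctional … (‖vᵢ⁺ − vᵢ⁻‖)`) along a
hard-sphere trajectory on `𝕋³`:

* §1 monotonicity in the window (`speedJump_mono_left`, `speedJump_between_le`) and the `L¹(dx₀)` time moduli of
  helper C in WINDOW form: for `|s − t₀| ≤ δ`, `∫ |ρ_r(s) − ρ_r(t₀)| ≤ δ(8/r)(½ + ke)`,
  `∫ ‖m_r(s) − m_r(t₀)‖ ≤ δ(8/r)(2ke) + (N+1)⁻¹(8ε/r)·½𝒮(t₀ − δ, t₀ + δ]`;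
* §2 `lintegral_speedJump_window_le` — FUBINI OVER THE WINDOW CENTRE: `∫_{t₀ ∈ [lo,hi]} 𝒮(t₀−δ, t₀+δ] dt₀ ≤
  2δ 𝒮(lo − δ, hi + δ]` (each collision is seen by the centres within `δ` of it);
* §3 `speedJump_le_two_mul_integral` — at a collision the speed jump `‖vᵢ⁺ − vᵢ⁻‖ = |(vᵢ − vⱼ)·n̂|` is at most
  `‖vᵢ⁻ − vⱼ⁻‖ ≤ 2(1 + ‖vᵢ⁻‖⁴ + ‖vⱼ⁻‖⁴)(1 + 1/(π‖vᵢ⁻ − vⱼ⁻‖))`, so along a good orbit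
  `𝒮(0, τ] ≤ 2 ∫ (1 + ‖v‖⁴ + ‖w‖⁴)(1 + 1/(π‖v − w‖)) d(empiricalCollisionMeasure [0,τ])` — the statistic of
  `LimitCollisionMeasure.CollisionTightness` (13354), whose marks are the PRE-collisional velocities
  `reflectVel (xᵢ − xⱼ) (vᵢ, vⱼ)` of the (outgoing) recorded configuration.

REFERENCES.  Elementary; trajectory kit `Literature/Analysis/FluidPDE/CollisionalTransferFunctional.lean`,
`HardSphereCollisionRecord.lean`, `EmpiricalCollisionMeasure.lean`.
-/

noncomputable section

namespace Summit.AtomisticToContinuum.HydrodynamicLimit.Theorems.ParityBandClosureWindowToCone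

open scoped BigOperators Topology Classical MeasureTheory ENNReal InnerProductSpace
open Filter Set MeasureTheory Function
open Literature.MathematicalPhysics.KineticTheory
open Literature.Analysis.FluidPDE
open Literature.Analysis.FunctionSpaces
open Summit.AtomisticToContinuum.HydrodynamicLimit.Theorems.LocalSecondLawNegative
open Summit.AtomisticToContinuum.HydrodynamicLimit.Theorems.LocalSecondLawLedger
open Summit.AtomisticToContinuum.HydrodynamicLimit.Theorems.ChaosClosesEulerReduction
open Summit.AtomisticToContinuum.HydrodynamicLimit.Theorems.ChaosClosesEulerStressIsotropy

variable {N : ℕ}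

/-! ## §1 Monotonicity of the speed-jump functional and the moduli in window form -/

section Mono

variable {d : Type*} [Fintype d] {X : Type*} [TopologicalSpace X] {n : ℕ} {G : Geometry d X} {ε : ℝ}
  {γ : ℝ → Config n d X} {g : Fin n → Fin n → Config n d X → Config n d X → ℝ}

/-- A collision-indexed functional with a nonnegative kernel is nonnegative. [folklore] -/
theorem ctf_nonneg (hg : ∀ i j pre post, 0 ≤ g i j pre post) (a b : ℝ) :
    0 ≤ collisionalTransferFunctional G ε g γ a b := by
  rw [collisionalTransferFunctional]
  exact finsum_nonneg fun t => finsum_nonneg fun _ => Finset.sum_nonneg fun p _ => hg _ _ _ _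

/-- Monotonicity in the right end of the window. [folklore] -/
theorem ctf_mono_right (h : IsHardSphereTrajectory G ε n γ) (hg : ∀ i j pre post, 0 ≤ g i j pre post)
    {a b c : ℝ} (hab : a ≤ b) (hbc : b ≤ c) :
    collisionalTransferFunctional G ε g γ a b ≤ collisionalTransferFunctional G ε g γ a c := by
  rw [← h.collisionalTransferFunctional_add_adjacent g hab hbc]
  exact le_add_of_nonneg_right (ctf_nonneg hg b c)

/-- Monotonicity in the left end of the window. [folklore] -/
theorem ctf_mono_left (h : IsHardSphereTrajectory G ε n γ) (hg : ∀ i j pre post, 0 ≤ g i j pre post)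
    {a b c : ℝ} (hab : a ≤ b) (hbc : b ≤ c) :
    collisionalTransferFunctional G ε g γ b c ≤ collisionalTransferFunctional G ε g γ a c := by
  rw [← h.collisionalTransferFunctional_add_adjacent g hab hbc]
  exact le_add_of_nonneg_left (ctf_nonneg hg a b)

/-- **The functional between two instants of one window**: if `|s − t₀| ≤ δ` then
`𝒮(min s t₀, max s t₀] ≤ 𝒮(t₀ − δ, t₀ + δ]`. [folklore] -/
theorem ctf_between_le (h : IsHardSphereTrajectory G ε n γ) (hg : ∀ i j pre post, 0 ≤ g i j pre post)
    {s t₀ δ : ℝ} (hs : |s - t₀| ≤ δ) :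
    collisionalTransferFunctional G ε g γ (min s t₀) (max s t₀) ≤
      collisionalTransferFunctional G ε g γ (t₀ - δ) (t₀ + δ) := by
  rw [abs_le] at hs
  calc collisionalTransferFunctional G ε g γ (min s t₀) (max s t₀)
      ≤ collisionalTransferFunctional G ε g γ (min s t₀) (t₀ + δ) :=
        ctf_mono_right h hg min_le_max (max_le (by linarith) (by linarith))
    _ ≤ collisionalTransferFunctional G ε g γ (t₀ - δ) (t₀ + δ) :=
        ctf_mono_left h hg (le_min (by linarith) (by linarith)) (min_le_right _ _ |>.trans (by linarith))

end Mono

/-- **Density modulus in window form**: `∫ |ρ_r(γ s) − ρ_r(γ t₀)| dx₀ ≤ δ (8/r)(½ + ke)` for `|s − t₀| ≤ δ`.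
[folklore] -/
theorem integral_abs_rhoC_window_le {ε : ℝ} {γ : ℝ → Phase N}
    (h : IsHardSphereTrajectory (Torus.geometry (Fin 3)) ε (N + 1) γ) {r : ℝ} (hr : 0 < r) (hr2 : r < 1 / 2)
    {s t₀ δ : ℝ} (hs : |s - t₀| ≤ δ) (u : ℝ) :
    ∫ x, |rhoC r (γ s) x - rhoC r (γ t₀) x| ≤ δ * (8 / r * (1 / 2 + ke (γ u))) := by
  have hke : ∀ a, ke (γ a) = ke (γ u) := fun a => ke_traj_eq h a u
  have hC : 0 ≤ 8 / r * (1 / 2 + ke (γ u)) := by have := ke_nonneg (γ u); positivity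
  rcases le_total t₀ s with hts | hst
  · have h1 := integral_abs_rhoC_sub_le h hr hr2 hts
    rw [hke] at h1
    refine h1.trans (mul_le_mul_of_nonneg_right ?_ hC)
    rw [abs_le] at hs; linarith
  · have h1 := integral_abs_rhoC_sub_le h hr hr2 hst
    rw [hke] at h1
    have e : ∀ x, |rhoC r (γ s) x - rhoC r (γ t₀) x| = |rhoC r (γ t₀) x - rhoC r (γ s) x| := fun x => abs_sub_comm _ _
    simp_rw [e]
    refine h1.trans (mul_le_mul_of_nonneg_right ?_ hC)
    rw [abs_le] at hs; linarith

/-- **Momentum modulus in window form**: for `|s − t₀| ≤ δ`,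
`∫ ‖m_r(γ s) − m_r(γ t₀)‖ dx₀ ≤ δ (8/r)(2 ke) + (N+1)⁻¹ (8ε/r) ½ 𝒮(t₀ − δ, t₀ + δ]` (`ε ≥ 0`). [folklore] -/
theorem integral_norm_momC_window_le {ε : ℝ} (hε : 0 ≤ ε) {γ : ℝ → Phase N}
    (h : IsHardSphereTrajectory (Torus.geometry (Fin 3)) ε (N + 1) γ) {r : ℝ} (hr : 0 < r) (hr2 : r < 1 / 2)
    {s t₀ δ : ℝ} (hs : |s - t₀| ≤ δ) (u : ℝ) :
    ∫ x, ‖momC r (γ s) x - momC r (γ t₀) x‖ ≤ δ * (8 / r * (2 * ke (γ u))) +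
      ((N + 1 : ℕ) : ℝ)⁻¹ * (8 * ε / r) * (2⁻¹ *
        collisionalTransferFunctional (Torus.geometry (Fin 3)) ε
          (fun i _ pre post => ‖(post i).2 - (pre i).2‖) γ (t₀ - δ) (t₀ + δ)) := by
  have hke : ∀ a, ke (γ a) = ke (γ u) := fun a => ke_traj_eq h a u
  have hg : ∀ (i j : Fin (N + 1)) (pre post : Phase N), 0 ≤ (fun i (_ : Fin (N + 1)) (pre post : Phase N) =>
      ‖(post i).2 - (pre i).2‖) i j pre post := fun _ _ _ _ => norm_nonneg _
  have hW := ctf_between_le h hg hs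
  have hC : 0 ≤ 8 / r * (2 * ke (γ u)) := by have := ke_nonneg (γ u); positivity
  have hD : 0 ≤ ((N + 1 : ℕ) : ℝ)⁻¹ * (8 * ε / r) :=
    mul_nonneg (by positivity) (div_nonneg (mul_nonneg (by norm_num) hε) hr.le)
  rcases le_total t₀ s with hts | hst
  · have h1 := integral_norm_momC_sub_le h hr hr2 hts
    rw [hke, min_eq_right hts, max_eq_left hts] at *
    have h2 : s - t₀ ≤ δ := by rw [abs_le] at hs; linarith
    calc _ ≤ _ := h1
      _ ≤ _ := add_le_add (mul_le_mul_of_nonneg_right h2 hC)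
          (mul_le_mul_of_nonneg_left (mul_le_mul_of_nonneg_left hW (by norm_num)) hD)
  · have h1 := integral_norm_momC_sub_le h hr hr2 hst
    rw [hke, min_eq_left hst, max_eq_right hst] at *
    have e : ∀ x, ‖momC r (γ s) x - momC r (γ t₀) x‖ = ‖momC r (γ t₀) x - momC r (γ s) x‖ := fun x => norm_sub_rev _ _
    simp_rw [e]
    have h2 : t₀ - s ≤ δ := by rw [abs_le] at hs; linarith
    calc _ ≤ _ := h1
      _ ≤ _ := add_le_add (mul_le_mul_of_nonneg_right h2 hC)
          (mul_le_mul_of_nonneg_left (mul_le_mul_of_nonneg_left hW (by norm_num)) hD)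

/-! ## §2 Fubini over the window centre -/

section WindowFubini

variable {d : Type*} [Fintype d] {X : Type*} [TopologicalSpace X] {n : ℕ} {G : Geometry d X} {ε : ℝ}
  {γ : ℝ → Config n d X} {g : Fin n → Fin n → Config n d X → Config n d X → ℝ}

/-- **Pointwise form of a window functional as a sum over a fixed finite collision set**: for
`t₀ ∈ [lo, hi]`, `𝒮(t₀ − δ, t₀ + δ] ≤ Σ_{t ∈ coll ∩ (lo−δ, hi+δ]} 1_{[t−δ, t+δ)}(t₀) s(t)` (nonnegative kernel).
[folklore] -/
theorem ctf_window_le_sum_indicator (h : IsHardSphereTrajectory G ε n γ) (hg : ∀ i j pre post, 0 ≤ g i j pre post)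
    {δ lo hi t₀ : ℝ} (ht₀ : t₀ ∈ Icc lo hi) :
    collisionalTransferFunctional G ε g γ (t₀ - δ) (t₀ + δ) ≤
      ∑ t ∈ (h.finite_collisionTimes_inter_Ioc (lo - δ) (hi + δ)).toFinset,
        (Ico (t - δ) (t + δ)).indicator
          (fun _ => ∑ p ∈ collidingPairs G ε (γ t), g p.1 p.2 (Function.leftLim γ t) (γ t)) t₀ := by
  rw [collisionalTransferFunctional_eq_sum g (h.finite_collisionTimes_inter_Ioc (t₀ - δ) (t₀ + δ))]
  have hsub : (h.finite_collisionTimes_inter_Ioc (t₀ - δ) (t₀ + δ)).toFinset ⊆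
      (h.finite_collisionTimes_inter_Ioc (lo - δ) (hi + δ)).toFinset := by
    intro t ht
    rw [Set.Finite.mem_toFinset] at ht ⊢
    exact ⟨ht.1, by linarith [ht.2.1, ht₀.1], by linarith [ht.2.2, ht₀.2]⟩
  calc ∑ t ∈ (h.finite_collisionTimes_inter_Ioc (t₀ - δ) (t₀ + δ)).toFinset,
        ∑ p ∈ collidingPairs G ε (γ t), g p.1 p.2 (Function.leftLim γ t) (γ t)
      = ∑ t ∈ (h.finite_collisionTimes_inter_Ioc (t₀ - δ) (t₀ + δ)).toFinset, (Ico (t - δ) (t + δ)).indicator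
          (fun _ => ∑ p ∈ collidingPairs G ε (γ t), g p.1 p.2 (Function.leftLim γ t) (γ t)) t₀ := by
        refine Finset.sum_congr rfl fun t ht => ?_
        rw [Set.Finite.mem_toFinset] at ht
        rw [Set.indicator_of_mem]
        exact ⟨by linarith [ht.2.2], by linarith [ht.2.1]⟩
    _ ≤ _ := Finset.sum_le_sum_of_subset_of_nonneg hsub fun t _ _ =>
        Set.indicator_nonneg (fun _ _ => Finset.sum_nonneg fun p _ => hg _ _ _ _) _

/-- **Fubini over the window centre**: `∫⁻_{t₀ ∈ [lo,hi]} 𝒮(t₀ − δ, t₀ + δ] ≤ 2δ 𝒮(lo − δ, hi + δ]` (nonnegative kernel;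
for `δ < 0` both sides vanish). [folklore] -/
theorem lintegral_ctf_window_le (h : IsHardSphereTrajectory G ε n γ) (hg : ∀ i j pre post, 0 ≤ g i j pre post)
    (δ lo hi : ℝ) :
    ∫⁻ t₀ in Icc lo hi, ENNReal.ofReal (collisionalTransferFunctional G ε g γ (t₀ - δ) (t₀ + δ)) ≤
      ENNReal.ofReal (2 * δ * collisionalTransferFunctional G ε g γ (lo - δ) (hi + δ)) := by
  set F := (h.finite_collisionTimes_inter_Ioc (lo - δ) (hi + δ)).toFinset with hF
  set c : ℝ → ℝ := fun t => ∑ p ∈ collidingPairs G ε (γ t), g p.1 p.2 (Function.leftLim γ t) (γ t) with hc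
  have hc0 : ∀ t, 0 ≤ c t := fun t => Finset.sum_nonneg fun p _ => hg _ _ _ _
  have hpt : ∀ t₀ ∈ Icc lo hi, ENNReal.ofReal (collisionalTransferFunctional G ε g γ (t₀ - δ) (t₀ + δ)) ≤
      ∑ t ∈ F, ENNReal.ofReal ((Ico (t - δ) (t + δ)).indicator (fun _ => c t) t₀) := by
    intro t₀ ht₀
    refine (ENNReal.ofReal_le_ofReal (ctf_window_le_sum_indicator h hg ht₀)).trans_eq ?_
    exact ENNReal.ofReal_sum_of_nonneg fun t _ => Set.indicator_nonneg (fun _ _ => hc0 t) _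
  calc ∫⁻ t₀ in Icc lo hi, ENNReal.ofReal (collisionalTransferFunctional G ε g γ (t₀ - δ) (t₀ + δ))
      ≤ ∫⁻ t₀ in Icc lo hi, ∑ t ∈ F, ENNReal.ofReal ((Ico (t - δ) (t + δ)).indicator (fun _ => c t) t₀) :=
        setLIntegral_mono' measurableSet_Icc fun t₀ ht₀ => hpt t₀ ht₀
    _ = ∑ t ∈ F, ∫⁻ t₀ in Icc lo hi, ENNReal.ofReal ((Ico (t - δ) (t + δ)).indicator (fun _ => c t) t₀) :=
        lintegral_finsetSum _ fun t _ => (measurable_const.indicator measurableSet_Ico).ennreal_ofReal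
    _ ≤ ∑ t ∈ F, ENNReal.ofReal (c t) * ENNReal.ofReal (2 * δ) := by
        refine Finset.sum_le_sum fun t _ => ?_
        calc ∫⁻ t₀ in Icc lo hi, ENNReal.ofReal ((Ico (t - δ) (t + δ)).indicator (fun _ => c t) t₀)
            ≤ ∫⁻ t₀, ENNReal.ofReal ((Ico (t - δ) (t + δ)).indicator (fun _ => c t) t₀) :=
              setLIntegral_le_lintegral _ _
          _ = ∫⁻ t₀, (Ico (t - δ) (t + δ)).indicator (fun _ => ENNReal.ofReal (c t)) t₀ := by
              refine lintegral_congr fun t₀ => ?_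
              by_cases hm : t₀ ∈ Ico (t - δ) (t + δ)
              · rw [Set.indicator_of_mem hm, Set.indicator_of_mem hm]
              · rw [Set.indicator_of_notMem hm, Set.indicator_of_notMem hm, ENNReal.ofReal_zero]
          _ = ENNReal.ofReal (c t) * volume (Ico (t - δ) (t + δ)) := by
              rw [lintegral_indicator measurableSet_Ico, setLIntegral_const]
          _ = ENNReal.ofReal (c t) * ENNReal.ofReal (2 * δ) := by
              rw [Real.volume_Ico]; congr 1; congr 1; ring
    _ = ENNReal.ofReal (2 * δ * collisionalTransferFunctional G ε g γ (lo - δ) (hi + δ)) := by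
        rw [← Finset.sum_mul, ← ENNReal.ofReal_sum_of_nonneg fun t _ => hc0 t, ← ENNReal.ofReal_mul (Finset.sum_nonneg fun t _ => hc0 t),
          collisionalTransferFunctional_eq_sum g (h.finite_collisionTimes_inter_Ioc (lo - δ) (hi + δ))]
        congr 1
        ring

end WindowFubini

/-! ## §3 The speed jump at a collision and the quartic statistic -/

/-- `x ≤ 1 + x⁴` for every real `x`. [folklore] -/
theorem le_one_add_pow_four (x : ℝ) : x ≤ 1 + x ^ 4 := by
  nlinarith [sq_nonneg (x ^ 2 - 1), sq_nonneg (x - 1), sq_nonneg x, sq_nonneg (x ^ 2)]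

/-- **The speed jump is dominated by the quartic collision mark**: for every `n` and every pair `q = (v, w)`,
`‖(reflectVel n q).1 − v‖ ≤ 2 (1 + ‖v‖⁴ + ‖w‖⁴)(1 + 1/(π ‖v − w‖))`. [folklore] -/
theorem norm_reflectVel_fst_sub_le_quartic (n : V3) (q : V3 × V3) :
    ‖(reflectVel n q).1 - q.1‖ ≤ 2 * ((1 + ‖q.1‖ ^ 4 + ‖q.2‖ ^ 4) * (1 + 1 / (Real.pi * ‖q.1 - q.2‖))) := by
  -- the velocity change of one partner is the normal component of the relative velocity (the landed
  -- `RestartPrinciple.AgeDuhamelForgetting.mmr_norm_reflectVel_fst_sub_le`, re-derived inline to keep the imports light)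
  have h1 : ‖(reflectVel n q).1 - q.1‖ ≤ ‖q.1 - q.2‖ := by
    have h : (reflectVel n q).1 - q.1 = -((⟪q.1 - q.2, n⟫_ℝ / ‖n‖ ^ 2) • n) := by simp only [reflectVel]; abel
    rw [h, norm_neg, norm_smul, Real.norm_eq_abs, abs_div, abs_of_nonneg (sq_nonneg ‖n‖)]
    by_cases hn : n = 0
    · simp [hn]
    · rw [div_mul_eq_mul_div, div_le_iff₀ (by positivity), pow_two, ← mul_assoc]
      exact mul_le_mul_of_nonneg_right (abs_real_inner_le_norm _ _) (norm_nonneg _)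
  have h2 : ‖q.1 - q.2‖ ≤ ‖q.1‖ + ‖q.2‖ := norm_sub_le _ _
  have h3 := le_one_add_pow_four ‖q.1‖
  have h4 := le_one_add_pow_four ‖q.2‖
  have h5 : 1 ≤ 1 + 1 / (Real.pi * ‖q.1 - q.2‖) := by
    have : 0 ≤ 1 / (Real.pi * ‖q.1 - q.2‖) := by positivity
    linarith
  have ha : 0 ≤ ‖q.1‖ ^ 4 := by positivity
  have hb : 0 ≤ ‖q.2‖ ^ 4 := by positivity
  calc ‖(reflectVel n q).1 - q.1‖ ≤ 2 * (1 + ‖q.1‖ ^ 4 + ‖q.2‖ ^ 4) * 1 := by linarith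
    _ ≤ 2 * (1 + ‖q.1‖ ^ 4 + ‖q.2‖ ^ 4) * (1 + 1 / (Real.pi * ‖q.1 - q.2‖)) :=
        mul_le_mul_of_nonneg_left h5 (by positivity)
    _ = _ := by ring

/-- **The pre-collisional velocities from the outgoing configuration.**  At a collision time, for every ordered
contact pair `(i, j)`, the left-limit velocity of `i` is the first component of the reflection of the recorded
(outgoing) pair: `vᵢ⁻ = (reflectVel (xᵢ − xⱼ) (vᵢ, vⱼ)).1`. [folklore] -/
theorem leftLim_vel_eq_reflectVel_fst {d : Type*} [Fintype d] {X : Type*} [TopologicalSpace X] [T2Space X] {n : ℕ}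
    {G : Geometry d X} {ε : ℝ} {γ : ℝ → Config n d X} (h : IsHardSphereTrajectory G ε n γ)
    (hG : ∀ x : X, Continuous (G.translate x)) {t : ℝ} {i j : Fin n} (hij : i ≠ j)
    (hc : γ t ∈ contactSet G n ε i j) :
    (Function.leftLim γ t i).2 = (reflectVel (G.sepVec (γ t i).1 (γ t j).1) ((γ t i).2, (γ t j).2)).1 := by
  obtain ⟨-, heq⟩ := h.eq_collidePair_leftLim hij hc
  set zl := Function.leftLim γ t with hzl
  have hpi : (zl i).1 = (γ t i).1 := h.leftLim_apply_fst hG t i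
  have hpj : (zl j).1 = (γ t j).1 := h.leftLim_apply_fst hG t j
  have hvi : (γ t i).2 = (reflectVel (G.sepVec (zl i).1 (zl j).1) ((zl i).2, (zl j).2)).1 := by
    conv_lhs => rw [heq, collidePair_apply_left hij]
  have hvj : (γ t j).2 = (reflectVel (G.sepVec (zl i).1 (zl j).1) ((zl i).2, (zl j).2)).2 := by
    conv_lhs => rw [heq, collidePair_apply_right]
  rw [← hpi, ← hpj, hvi, hvj, Prod.mk.eta, reflectVel_reflectVel]

/-- On the torus, `collidingPairs` (contact in either order) are the ordered contact pairs (contact is symmetric in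
a regular geometry). [folklore] -/
theorem collidingPairs_eq_contactPairs {d : Type*} [Fintype d] {X : Type*} [TopologicalSpace X] {n : ℕ}
    {G : Geometry d X} {ε : ℝ} (hG : G.IsHardSphereRegular ε) (z : Config n d X) :
    collidingPairs G ε z = contactPairs G ε z := by
  ext p
  rw [mem_collidingPairs, mem_contactPairs]
  constructor
  · rintro ⟨hne, hc | hc⟩
    · exact ⟨hne, hc⟩
    · exact ⟨hne, hG.mem_contactSet_comm.1 hc⟩
  · rintro ⟨hne, hc⟩
    exact ⟨hne, Or.inl hc⟩

/-- **The speed-jump functional is dominated by the quartic collision statistic of `CollisionTightness`.**  Along a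
good orbit of the hard-sphere flow on `𝕋³` at reduced diameter `σ < 1/2`, for `τ ≥ 0`:
`𝒮(0, τ] ≤ 2 ∫ (1 + ‖v‖⁴ + ‖w‖⁴)(1 + 1/(π‖v − w‖)) d(empiricalCollisionMeasure [0, τ])`. [folklore] -/
theorem speedJump_le_two_mul_integral {σ : ℝ} (hσ : 0 < σ) (hσ2 : σ < 1 / 2)
    (Φ : HardSphereFlow (Torus.geometry (Fin 3)) (hsDiameter σ N) (N + 1)) {z : Phase N} (hz : z ∈ Φ.good)
    (τ : ℝ) :
    collisionalTransferFunctional (Torus.geometry (Fin 3)) (hsDiameter σ N)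
        (fun i _ pre post => ‖(post i).2 - (pre i).2‖) (fun s => Φ.flow s z) 0 τ ≤
      2 * ∫ m, (1 + ‖m.2.2.2.1‖ ^ 4 + ‖m.2.2.2.2‖ ^ 4) * (1 + 1 / (Real.pi * ‖m.2.2.2.1 - m.2.2.2.2‖))
        ∂(Φ.empiricalCollisionMeasure (Set.Icc 0 τ) z) := by
  have hε2 : hsDiameter σ N < 2⁻¹ := (hsDiameter_le hσ.le N).trans_lt (by rw [inv_eq_one_div]; exact hσ2)
  have hG : (Torus.geometry (Fin 3)).IsHardSphereRegular (hsDiameter σ N) := Torus.isHardSphereRegular_geometry hε2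
  have hGc : ∀ x : T3, Continuous ((Torus.geometry (Fin 3)).translate x) := fun x => continuous_const.add Torus.continuous_proj
  have htraj : IsHardSphereTrajectory (Torus.geometry (Fin 3)) (hsDiameter σ N) (N + 1) (fun s => Φ.flow s z) :=
    Φ.isTrajectory z hz
  -- unfold the integral to the inline collision sum
  rw [Φ.integral_empiricalCollisionMeasure_eq_finsum_ite hz (Subset.refl (Set.Icc 0 τ))]
  have hfin1 := htraj.finite_collisionTimes_inter_Ioc 0 τ
  have hfin2 : (collisionTimes (Torus.geometry (Fin 3)) (hsDiameter σ N) (fun s => Φ.flow s z) ∩ Set.Icc 0 τ).Finite :=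
    htraj.locFinite 0 τ
  rw [collisionalTransferFunctional_eq_sum _ hfin1, finsum_mem_eq_finite_toFinset_sum _ hfin2, Finset.mul_sum]
  have hsub : hfin1.toFinset ⊆ hfin2.toFinset := by
    intro t ht
    rw [Set.Finite.mem_toFinset] at ht ⊢
    exact ⟨ht.1, Ioc_subset_Icc_self ht.2⟩
  refine le_trans (Finset.sum_le_sum fun t ht => ?_) (Finset.sum_le_sum_of_subset_of_nonneg hsub fun t _ _ => ?_)
  · -- one collision time
    rw [collidingPairs_eq_contactPairs hG, sum_contactPairs_eq (htraj.mem t)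
      (fun i j => ‖(Φ.flow t z i).2 - (Function.leftLim (fun s => Φ.flow s z) t i).2‖), Finset.mul_sum]
    refine Finset.sum_le_sum fun i _ => ?_
    rw [Finset.mul_sum]
    refine Finset.sum_le_sum fun j _ => ?_
    split_ifs with hcond
    · have hc : (fun s => Φ.flow s z) t ∈ contactSet (Torus.geometry (Fin 3)) (N + 1) (hsDiameter σ N) i j :=
        ⟨htraj.mem t, hcond.2⟩
      have hl := leftLim_vel_eq_reflectVel_fst htraj hGc hcond.1 hc
      rw [hl]
      set q := reflectVel ((Torus.geometry (Fin 3)).sepVec (Φ.flow t z i).1 (Φ.flow t z j).1)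
        ((Φ.flow t z i).2, (Φ.flow t z j).2) with hq
      have hv : (Φ.flow t z i).2 = (reflectVel ((Torus.geometry (Fin 3)).sepVec (Φ.flow t z i).1 (Φ.flow t z j).1) q).1 := by
        rw [hq, reflectVel_reflectVel]
      rw [hv]
      exact norm_reflectVel_fst_sub_le_quartic _ q
    · simp
  · refine mul_nonneg (by norm_num) (Finset.sum_nonneg fun i _ => Finset.sum_nonneg fun j _ => ?_)
    split_ifs
    · positivity
    · exact le_rfl

/-! ## §4 Registered sub-goal -/

/-- **Registered sub-goal `stub_stressIsotropyOfWindowCovarianceD` (helper D of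
`stub_stressIsotropyOfWindowCovariance`): the speed jump against the quartic collision mark** — for every impact
vector `n` and every pair `(v, w)`, `‖(reflectVel n (v, w)).1 − v‖ ≤ 2(1 + ‖v‖⁴ + ‖w‖⁴)(1 + 1/(π‖v − w‖))`, the
pointwise inequality that prices the windowed speed-jump functional by `CollisionTightness`. [folklore] -/
theorem stub_stressIsotropyOfWindowCovarianceD : ∀ (n : V3) (q : V3 × V3), ‖(reflectVel n q).1 - q.1‖ ≤ 2 * ((1 + ‖q.1‖ ^ 4 + ‖q.2‖ ^ 4) * (1 + 1 / (Real.pi * ‖q.1 - q.2‖))) :=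
  fun n q => norm_reflectVel_fst_sub_le_quartic n q

end Summit.AtomisticToContinuum.HydrodynamicLimit.Theorems.ParityBandClosureWindowToCone

end
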